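import Summits.CriticalPhenomena.PercolationContinuityZ3.Theorems.PercNearOneGluingNoHeavyLowerTailCubicThreePointFibreHqtTable
import Summits.CriticalPhenomena.PercolationContinuityZ3.Theorems.PercNearOneGluingNoHeavyLowerTailCubicThreePointFiveVertices
import Summits.CriticalPhenomena.PercolationContinuityZ3.Theorems.PercNearOneGluingNoHeavyLowerTailCubicThreePointAGPrW
import HarnessLib

/-!
# `NoHeavyLowerTail` (stmt-CriticalPhenomena-4575) — `H_{q+t} ≥ 0` for EVERY weighted graph on five vertices (theta certificate + terminal chords)

Support file (prover prim-sahi-p2; `--supports stmt-CriticalPhenomena-4575`; COMPUTATIONAL: one `native_decide` certificate plus the inherited theta tables).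
The row `H_{q+t} = (q+t)·AG − e₃` (between Hmax and AG⁺: `H_{q+t} ⇒ AG⁺ ⇒ SHK3⁺`) for the three-point law of every weighted graph on ≤ 5 vertices:
(1) `hqtW_theta_nonneg` — the fibre certificate for the theta graph with the `H_{q+t}` pattern table `polTblH` (`theta_failH_zero`, ≈ 25 s), via
`hqtW_nonneg_of_fibM` (`…FibreHqtTable`) and the theta tables of `…FibreTheta`; (2) THEOREM A for `H_{q+t}` at graph level: a terminal chord moves the law by
`E_ab^l` (`PrW_insert_ab_ev*`, from `…ChordStep`) and `Hqt(E_ab^l x) = (1−l)·[(1−l)·Hqt(x) + l·((t+u₂+u₃)·AG(x) + t·u₂u₃) + l²·(u₂+u₃)u₂u₃]` (`Hqt_edge_ab'`, all terms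
≥ 0 given `AG ≥ 0` = `AG_PrW_nonneg`; no `q + t > 0` side condition) — `hqtW_insert_ab/ac/bc_nonneg`, loops `hqtW_insert_loop`; (3) assembly over `Sym2 (Fin 5)` =
Θ + 3 chords + 5 loops (`univ_sym2_fin5_eq`): `hqtW_univ_fin5_nonneg`, and in measure form `hqt_prodBernoulli_fin5_nonneg`.  External exact certificate for ≤ 6 vertices:
kit j072389 (run/shared/lean/prim/prim-sahi/prim-sahi-p2/PROOF-E3.md §6).
[cite: Gladkov2024StrongFKG, Cor. 4.2]
-/

noncomputable section

namespace Summit.CriticalPhenomena.PercolationContinuityZ3.Theorems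

namespace TerminalGluing

open Finset SimpleGraph Literature.Probability.Percolation Literature.Probability.Percolation.DecisionTree
open CubicThreePointStep CubicThreePointTerminal

variable {V : Type*} [DecidableEq V]

/-! ### THEOREM A for `H_{q+t}` with the `AG` side condition and no positivity of `q + t` -/

/-- `H_{q+t}` under `E_ab^l`, exactly: `Hqt(E_ab^l x) = (1−l)·[(1−l)·Hqt + l·((t+u₂+u₃)·AG + t·u₂u₃) + l²·(u₂+u₃)u₂u₃]`. [folklore] -/
theorem Hqt_edge_ab' {R : Type*} [CommRing R] (q u₁ u₂ u₃ t l : R) :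
    Hqt ((1 - l) * q) (u₁ + l * q) ((1 - l) * u₂) ((1 - l) * u₃) (t + l * (u₂ + u₃)) =
      (1 - l) * ((1 - l) * Hqt q u₁ u₂ u₃ t + l * ((t + u₂ + u₃) * AG q u₁ u₂ u₃ t + t * (u₂ * u₃))
        + l * l * ((u₂ + u₃) * (u₂ * u₃))) := by
  simp only [Hqt, AG]; ring

/-- THEOREM A (`H_{q+t}`, edge) with `AG ≥ 0` instead of `q + t > 0`. [cite: Gladkov2024StrongFKG, Cor. 4.2] -/
theorem Hqt_edge_ab_nonneg' {q u₁ u₂ u₃ t l : ℝ} (hu₂ : 0 ≤ u₂) (hu₃ : 0 ≤ u₃) (ht : 0 ≤ t) (hl₀ : 0 ≤ l) (hl₁ : l ≤ 1)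
    (hag : 0 ≤ AG q u₁ u₂ u₃ t) (hH : 0 ≤ Hqt q u₁ u₂ u₃ t) :
    0 ≤ Hqt ((1 - l) * q) (u₁ + l * q) ((1 - l) * u₂) ((1 - l) * u₃) (t + l * (u₂ + u₃)) := by
  rw [Hqt_edge_ab']
  have hm : 0 ≤ 1 - l := by linarith
  have h1 : 0 ≤ (t + u₂ + u₃) * AG q u₁ u₂ u₃ t + t * (u₂ * u₃) :=
    add_nonneg (mul_nonneg (by linarith) hag) (mul_nonneg ht (mul_nonneg hu₂ hu₃))
  have h2 : 0 ≤ (u₂ + u₃) * (u₂ * u₃) := mul_nonneg (add_nonneg hu₂ hu₃) (mul_nonneg hu₂ hu₃)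
  exact mul_nonneg hm (add_nonneg (add_nonneg (mul_nonneg hm hH) (mul_nonneg hl₀ h1)) (mul_nonneg (mul_nonneg hl₀ hl₀) h2))

/-! ### The law after adding a terminal chord `{a,b}` of weight `p {a,b}` -/

section ChordCells

variable (D : Finset (Sym2 V)) (p : Sym2 V → ℝ) (K : Finset (Sym2 V)) {a b : V} (c : V) (hab : a ≠ b) (he : s(a, b) ∉ D)
include hab he

/-- Cell `a|b|c` after the chord. [folklore] -/
theorem PrW_insert_ab_evQ : PrW (insert s(a, b) D) p (evQ K a b c) = (1 - p s(a, b)) * PrW D p (evQ K a b c) := by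
  rw [PrW_split D p he, sect_evQ, PrW_eq_zero_of_forall D p (fun S _ => not_mem_evQ_insert_ab K c hab S)]; ring

/-- Cell `ab|c` after the chord. [folklore] -/
theorem PrW_insert_ab_evU₁ :
    PrW (insert s(a, b) D) p (evU₁ K a b c) = PrW D p (evU₁ K a b c) + p s(a, b) * PrW D p (evQ K a b c) := by
  rw [PrW_split D p he, sect_evU₁, PrW_of_ind_add D p (fun S _ => ind_evU₁_insert_ab K c hab S)]; ring

/-- Cell `ac|b` after the chord. [folklore] -/
theorem PrW_insert_ab_evU₂ : PrW (insert s(a, b) D) p (evU₂ K a b c) = (1 - p s(a, b)) * PrW D p (evU₂ K a b c) := by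
  rw [PrW_split D p he, sect_evU₂, PrW_eq_zero_of_forall D p (fun S _ => not_mem_evU₂_insert_ab K c hab S)]; ring

/-- Cell `bc|a` after the chord. [folklore] -/
theorem PrW_insert_ab_evU₃ : PrW (insert s(a, b) D) p (evU₃ K a b c) = (1 - p s(a, b)) * PrW D p (evU₃ K a b c) := by
  rw [PrW_split D p he, sect_evU₃, PrW_eq_zero_of_forall D p (fun S _ => not_mem_evU₃_insert_ab K c hab S)]; ring

/-- Cell `abc` after the chord. [folklore] -/
theorem PrW_insert_ab_evT : PrW (insert s(a, b) D) p (evT K a b c) =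
    PrW D p (evT K a b c) + p s(a, b) * (PrW D p (evU₂ K a b c) + PrW D p (evU₃ K a b c)) := by
  rw [PrW_split D p he, sect_evT, PrW_of_ind_add3 D p (fun S _ => ind_evT_insert_ab K c hab S)]; ring

end ChordCells

/-! ### `H_{q+t}` survives terminal chords and loops -/

section Chord

variable (D : Finset (Sym2 V)) {p : Sym2 V → ℝ} (hp0 : ∀ i, 0 ≤ p i) (hp1 : ∀ i, p i ≤ 1) (K : Finset (Sym2 V)) {a b : V} (c : V)
include hp0 hp1

/-- **THEOREM A (`H_{q+t}`, edge) for graphs.** [cite: Gladkov2024StrongFKG, Cor. 4.2] -/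
theorem hqtW_insert_ab_nonneg (hab : a ≠ b) (he : s(a, b) ∉ D) (hH : 0 ≤ hqtW D p K a b c) :
    0 ≤ hqtW (insert s(a, b) D) p K a b c := by
  unfold hqtW at hH ⊢
  rw [PrW_insert_ab_evQ D p K c hab he, PrW_insert_ab_evU₁ D p K c hab he, PrW_insert_ab_evU₂ D p K c hab he,
    PrW_insert_ab_evU₃ D p K c hab he, PrW_insert_ab_evT D p K c hab he]
  exact Hqt_edge_ab_nonneg' (PrW_nonneg D hp0 hp1 _) (PrW_nonneg D hp0 hp1 _) (PrW_nonneg D hp0 hp1 _) (hp0 _) (hp1 _)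
    (AG_PrW_nonneg a b c hp0 hp1 D K) hH

omit hp0 hp1 in
/-- `hqtW` is symmetric under `a ↔ b`. [folklore] -/
theorem hqtW_swap12 (p : Sym2 V → ℝ) (a b c : V) : hqtW D p K b a c = hqtW D p K a b c := by
  unfold hqtW
  rw [evT_swap12 K a b c, evU₁_swap12 K a b c, evU₂_swap12 K a b c, evU₃_swap12 K a b c, evQ_swap12 K a b c]
  simp only [Hqt]; ring

omit hp0 hp1 in
/-- `hqtW` is symmetric under `a ↔ c`. [folklore] -/
theorem hqtW_swap13 (p : Sym2 V → ℝ) (a b c : V) : hqtW D p K c b a = hqtW D p K a b c := by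
  unfold hqtW
  rw [evT_swap13 K a b c, evU₁_swap13 K a b c, evU₂_swap13 K a b c, evU₃_swap13 K a b c, evQ_swap13 K a b c]
  simp only [Hqt]; ring

omit hp0 hp1 in
/-- `hqtW` is symmetric under `b ↔ c`. [folklore] -/
theorem hqtW_swap23 (p : Sym2 V → ℝ) (a b c : V) : hqtW D p K a c b = hqtW D p K a b c := by
  rw [hqtW_swap13 D K p b c a, hqtW_swap12 D K p c b a, hqtW_swap13 D K p a b c]

/-- THEOREM A (`H_{q+t}`) for the chord `{a,c}`. [cite: Gladkov2024StrongFKG, Cor. 4.2] -/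
theorem hqtW_insert_ac_nonneg (hac : a ≠ c) (he : s(a, c) ∉ D) (hH : 0 ≤ hqtW D p K a b c) :
    0 ≤ hqtW (insert s(a, c) D) p K a b c := by
  rw [← hqtW_swap23 (insert s(a, c) D) K p a b c]
  rw [← hqtW_swap23 D K p a b c] at hH
  exact hqtW_insert_ab_nonneg D hp0 hp1 K b hac he hH

/-- THEOREM A (`H_{q+t}`) for the chord `{b,c}`. [cite: Gladkov2024StrongFKG, Cor. 4.2] -/
theorem hqtW_insert_bc_nonneg (hbc : b ≠ c) (he : s(b, c) ∉ D) (hH : 0 ≤ hqtW D p K a b c) :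
    0 ≤ hqtW (insert s(b, c) D) p K a b c := by
  have he' : s(c, b) ∉ D := by rwa [Sym2.eq_swap] at he
  have hH' : 0 ≤ hqtW D p K c b a := by rwa [← hqtW_swap13 D K p a b c] at hH
  have h := hqtW_insert_ab_nonneg D hp0 hp1 K a (Ne.symm hbc) he' hH'
  rwa [Sym2.eq_swap, hqtW_swap13] at h

omit hp0 hp1 in
/-- Adding a loop to `D` does not change `hqtW`. [folklore] -/
theorem hqtW_insert_loop (p : Sym2 V → ℝ) (a b c : V) {v : V} (he : s(v, v) ∉ D) :
    hqtW (insert s(v, v) D) p K a b c = hqtW D p K a b c := by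
  have key : ∀ X : Set (Finset (Sym2 V)), (∀ S, insert s(v, v) S ∈ X ↔ S ∈ X) → PrW (insert s(v, v) D) p X = PrW D p X := by
    intro X hX
    rw [PrW_split D p he]
    have : {S | insert s(v, v) S ∈ X} = X := Set.ext hX
    rw [this]; ring
  unfold hqtW
  rw [key (evQ K a b c) (fun S => by simp only [mem_evQ, R_insert_config_iff, R_insert_loop_iff]),
    key (evU₁ K a b c) (fun S => by simp only [mem_evU₁, R_insert_config_iff, R_insert_loop_iff]),
    key (evU₂ K a b c) (fun S => by simp only [mem_evU₂, R_insert_config_iff, R_insert_loop_iff]),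
    key (evU₃ K a b c) (fun S => by simp only [mem_evU₃, R_insert_config_iff, R_insert_loop_iff]),
    key (evT K a b c) (fun S => by simp only [mem_evT, R_insert_config_iff, R_insert_loop_iff])]

end Chord

/-! ### The theta certificate for `H_{q+t}` -/

section Theta

/-- The table of the 125 values of `PolZH`. [folklore] -/
def polTblH : Array ℤ :=
  (Array.range 125).map (fun i => PolZH (Fin.ofNat 5 (i / 25)) (Fin.ofNat 5 (i / 5)) (Fin.ofNat 5 i))

/-- `PolZH` read from the table. [folklore] -/
def polTH : Fin 5 → Fin 5 → Fin 5 → ℤ := fun s₁ s₂ s₃ => polTblH.getD (s₁.val * 25 + s₂.val * 5 + s₃.val) 0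

/-- The table is correct. [folklore] -/
theorem polTH_eq : ∀ s₁ s₂ s₃ : Fin 5, polTH s₁ s₂ s₃ = PolZH s₁ s₂ s₃ := by native_decide

/-- **The certificate**: no profile of `Θ` has a negative `H_{q+t}` fibre sum (4⁷ profiles, 8⁷ colourings, ≈ 25 s). [folklore] -/
theorem theta_failH_zero : fibFailTP thetaD (fun _ _ _ => true) thetaIdx polTblH thetaTable subTbl = 0 := by
  native_decide

/-- All `H_{q+t}` fibre sums of `Θ` are nonnegative. [folklore] -/
theorem theta_fibH_nonneg :
    ∀ A₁ ∈ thetaD.powerset, ∀ A₂ ∈ A₁.powerset, ∀ A₃ ∈ A₂.powerset, 0 ≤ FibM thetaIdx polTH thetaSt subT (A₁, A₂, A₃) :=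
  fun A₁ h₁ A₂ h₂ A₃ h₃ => of_fibFailTP theta_failH_zero A₁ h₁ A₂ h₂ A₃ h₃ rfl

/-- **`H_{q+t} ≥ 0` for EVERY weighting of the theta graph.** [folklore] -/
theorem hqtW_theta_nonneg (p : Sym2 (Fin 5) → ℝ) (hp0 : ∀ e, 0 ≤ p e) (hp1 : ∀ e, p e ≤ 1) :
    0 ≤ hqtW thetaD p ∅ (0 : Fin 5) 1 2 :=
  hqtW_nonneg_of_fibM thetaD ∅ 0 1 2 thetaIdx polTH thetaSt subT p hp0 hp1 thetaIdx_inj polTH_eq subT_eq thetaSt_ok theta_fibH_nonneg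

end Theta

/-! ### All weighted graphs on five vertices -/

section Fin5

/-- **`H_{q+t} ≥ 0` for every weighting of `K₅`** (terminals `0,1,2`): theta certificate, three terminal chords, five loops. [folklore] -/
theorem hqtW_univ_fin5_nonneg (p : Sym2 (Fin 5) → ℝ) (hp0 : ∀ e, 0 ≤ p e) (hp1 : ∀ e, p e ≤ 1) :
    0 ≤ hqtW (Finset.univ : Finset (Sym2 (Fin 5))) p ∅ (0 : Fin 5) 1 2 := by
  rw [univ_sym2_fin5_eq]
  simp (disch := decide) only [hqtW_insert_loop]
  refine hqtW_insert_ab_nonneg (insert s(0, 2) (insert s(1, 2) thetaD)) hp0 hp1 ∅ 2 (by decide) (by decide) ?_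
  refine hqtW_insert_ac_nonneg (insert s(1, 2) thetaD) hp0 hp1 ∅ 2 (by decide) (by decide) ?_
  refine hqtW_insert_bc_nonneg thetaD hp0 hp1 ∅ 2 (by decide) (by decide) ?_
  exact hqtW_theta_nonneg p hp0 hp1

/-- **AG⁺ (`Ξ = σ·AG − e₃ ≥ 0`) for every weighting of `K₅`**, from `H_{q+t} ≥ 0` and `AG ≥ 0` (`Ξ = H_{q+t} + (u₁+u₂+u₃)·AG`). [cite: Gladkov2024StrongFKG, Cor. 4.2] -/
theorem xiW_univ_fin5_nonneg (p : Sym2 (Fin 5) → ℝ) (hp0 : ∀ e, 0 ≤ p e) (hp1 : ∀ e, p e ≤ 1) :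
    0 ≤ Xi (PrW (Finset.univ : Finset (Sym2 (Fin 5))) p (evQ ∅ (0 : Fin 5) 1 2)) (PrW Finset.univ p (evU₁ ∅ (0 : Fin 5) 1 2))
      (PrW Finset.univ p (evU₂ ∅ (0 : Fin 5) 1 2)) (PrW Finset.univ p (evU₃ ∅ (0 : Fin 5) 1 2)) (PrW Finset.univ p (evT ∅ (0 : Fin 5) 1 2)) := by
  have hH := hqtW_univ_fin5_nonneg p hp0 hp1
  unfold hqtW at hH
  have hag := AG_PrW_nonneg (0 : Fin 5) 1 2 hp0 hp1 Finset.univ ∅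
  have hid : ∀ q u₁ u₂ u₃ t : ℝ, Xi q u₁ u₂ u₃ t = Hqt q u₁ u₂ u₃ t + (u₁ + u₂ + u₃) * AG q u₁ u₂ u₃ t := by
    intro q u₁ u₂ u₃ t; simp only [Xi, Hqt, AG]; ring
  rw [hid]
  exact add_nonneg hH (mul_nonneg (add_nonneg (add_nonneg (PrW_nonneg _ hp0 hp1 _) (PrW_nonneg _ hp0 hp1 _))
    (PrW_nonneg _ hp0 hp1 _)) hag)

open MeasureTheory Literature.Probability.LatticeModels in
/-- **`H_{q+t} ≥ 0` for every weighted graph on five vertices, in measure form**: for every `w : Sym2 (Fin 5) → [0,1]`, the three-point law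
`(μ(0|1|2), μ(01|2), μ(02|1), μ(12|0), μ(012))` of `μ = prodBernoulli w` satisfies `(q+t)(qt − e₂(u)) ≥ e₃(u)` (hence AG⁺ and SHK3⁺). [folklore] -/
theorem hqt_prodBernoulli_fin5_nonneg (w : Sym2 (Fin 5) → unitInterval) :
    0 ≤ Hqt ((prodBernoulli w).real ((openConn (0 : Fin 5) 1)ᶜ ∩ (openConn (0 : Fin 5) 2)ᶜ ∩ (openConn (1 : Fin 5) 2)ᶜ))
      ((prodBernoulli w).real (openConn (0 : Fin 5) 1 ∩ (openConn (0 : Fin 5) 2)ᶜ))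
      ((prodBernoulli w).real (openConn (0 : Fin 5) 2 ∩ (openConn (0 : Fin 5) 1)ᶜ))
      ((prodBernoulli w).real (openConn (1 : Fin 5) 2 ∩ (openConn (0 : Fin 5) 1)ᶜ))
      ((prodBernoulli w).real (openConn (0 : Fin 5) 1 ∩ openConn (0 : Fin 5) 2)) := by
  rw [real_cellQ, real_cellU₁, real_cellU₂, real_cellU₃, real_cellT]
  exact hqtW_univ_fin5_nonneg _ (fun e => unitInterval.nonneg (w e)) (fun e => unitInterval.le_one (w e))

end Fin5

end TerminalGluing

end Summit.CriticalPhenomena.PercolationContinuityZ3.Theorems
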